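import Summits.BirchSwinnertonDyer.BirchSwinnertonDyer.Theorems.CyclotomicUntwistPSIrrSurjThreeLeafReadings
import Summits.BirchSwinnertonDyer.BirchSwinnertonDyer.Theorems.CyclotomicUntwistPSIdleBinders
import HarnessLib

/-!
# K1 / K2 of route `CyclotomicUntwist` in MINIMAL binders: «wild cyclic at `3`, `E[3]` irreducible,
# `Δ_min/3^v ≡ 1 (mod 3)`, `r_an = 1`» — `¬CM` is idle and `Surj` is `Irr`

Cell `pub/bsd-wall` (D-0145 line `route-BirchSwinnertonDyer-CyclotomicUntwist`), seat `bsd-line-cycu-p4`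
(width seat 4, gen 6). THEOREMS ONLY (no definition, no named fact, no `sorry`); BSD is not proved by this
file and no crux is. Helper `--supports` K1 (stmt-BirchSwinnertonDyer-21580). It composes two landed
binder laws of this lineage on the texts of K1 `PSRankOneLowerHalfAtThree` and K2
`PSRankOneUpperHalfAtThree`: the `¬ W.HasCM` binder is IDLE (`PSIdleBinders.psRankOne…_iff_cmFree`, cycu-p4
g4: `Surj W 3 ⇒ ¬CM`, Zywina) and the `Surj W 3` binder IS `Irr W 3` on the cyclic wild cell
(`PSIrrSurjThree.surj_three_iff_irr_of_cyclic`, LAW L-irr3). Result (**`psRankOneLowerHalfAtThree_iff_min`**,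
**`psRankOneUpperHalfAtThree_iff_min`**): each crux is EQUIVALENT to the statement with exactly five
binders — `ClassO6 W 3`, `Irr W 3`, `Even (v₃Δ_min)`, `Δ_min/3^v ≡ 1 (mod 3)`, `analyticRank = 1` — the
leanest faithful text of the cruxes (for the pen's K-SEP′ children and for any future line).

References: D. Zywina, arXiv:1508.07660 (2015) Prop. 1.14/1.16 [Zywina2015]; J.-P. Serre, Invent. Math. 15
(1972) §2.4 Prop. 15 [Serre1972]; A. Kraus, Manuscripta Math. 69 (1990) [Kraus1990].
-/

-- single-conjunct summit: `Summit.BirchSwinnertonDyer.BirchSwinnertonDyer.…` repeats the name by design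
set_option linter.dupNamespace false
set_option autoImplicit false

noncomputable section

open scoped Classical

namespace Summit.BirchSwinnertonDyer.BirchSwinnertonDyer.Theorems.PSIrrSurjThree

open WeierstrassCurve Literature.NumberTheory.EllipticCurves Literature.NumberTheory.EllipticCurves.Rank1Residual
  Summit.BirchSwinnertonDyer.Rank1Residual.Additive
  Summit.BirchSwinnertonDyer.BirchSwinnertonDyer.Theses.CyclotomicUntwist

/-- On the cyclic wild cell `E[3]` irreducible already excludes CM (`Irr ⇒ Surj ⇒ ¬CM`).
[cite: Zywina2015, Prop. 1.14 and Prop. 1.16] [cite: Serre1972, §2.4 Prop. 15] -/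
theorem not_hasCM_of_irr_of_cyclic (W : WeierstrassCurve ℚ) [W.IsElliptic] [W.IsGloballyMinimal]
    (hO6 : ClassO6 W 3) (hev : Even (padicValInt 3 W.minimalDiscriminantInt)) (hirr : Irr W 3) : ¬ W.HasCM :=
  PSIdleBinders.not_hasCM_of_surj_three W (surj_three_of_irr_of_cyclic W hO6 hev hirr)

/-- **K1 in minimal binders**: `PSRankOneLowerHalfAtThree` ⟺ «∀ W globally minimal, `ClassO6 W 3` →
`Irr W 3` → `v₃Δ_min` even → `Δ_min/3^v ≡ 1 (mod 3)` → `r_an = 1` → `MissingLowerBoundAt W 3`»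
(`¬CM` idle, `Surj = Irr` on these rows). [cite: Zywina2015, Prop. 1.14 and Prop. 1.16]
[cite: Serre1972, §2.4 Prop. 15] -/
theorem psRankOneLowerHalfAtThree_iff_min :
    PSRankOneLowerHalfAtThree ↔
      ∀ (W : WeierstrassCurve ℚ) [W.IsElliptic] [W.IsGloballyMinimal], ClassO6 W 3 → Irr W 3 →
        Even (padicValInt 3 W.minimalDiscriminantInt) →
        W.minimalDiscriminantInt / 3 ^ padicValInt 3 W.minimalDiscriminantInt % 3 = 1 →
        W.analyticRank = 1 → Typed.MissingLowerBoundAt W 3 := by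
  rw [psRankOneLowerHalfAtThree_iff_irr]
  exact ⟨fun h W _ _ hO6 hirr hev hsq hr ↦ h W (not_hasCM_of_irr_of_cyclic W hO6 hev hirr) hO6 hirr hev hsq hr,
    fun h W _ _ _ hO6 hirr hev hsq hr ↦ h W hO6 hirr hev hsq hr⟩

/-- **K2 in minimal binders**: `PSRankOneUpperHalfAtThree` ⟺ «∀ W globally minimal, `ClassO6 W 3` →
`Irr W 3` → `v₃Δ_min` even → `Δ_min/3^v ≡ 1 (mod 3)` → `r_an = 1` → `MissingUpperBoundAt W 3`».
[cite: Zywina2015, Prop. 1.14 and Prop. 1.16] [cite: Serre1972, §2.4 Prop. 15] -/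
theorem psRankOneUpperHalfAtThree_iff_min :
    PSRankOneUpperHalfAtThree ↔
      ∀ (W : WeierstrassCurve ℚ) [W.IsElliptic] [W.IsGloballyMinimal], ClassO6 W 3 → Irr W 3 →
        Even (padicValInt 3 W.minimalDiscriminantInt) →
        W.minimalDiscriminantInt / 3 ^ padicValInt 3 W.minimalDiscriminantInt % 3 = 1 →
        W.analyticRank = 1 → Typed.MissingUpperBoundAt W 3 := by
  rw [psRankOneUpperHalfAtThree_iff_irr]
  exact ⟨fun h W _ _ hO6 hirr hev hsq hr ↦ h W (not_hasCM_of_irr_of_cyclic W hO6 hev hirr) hO6 hirr hev hsq hr,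
    fun h W _ _ _ hO6 hirr hev hsq hr ↦ h W hO6 hirr hev hsq hr⟩

/-- **K1 ∧ K2 in minimal binders**, packaged for the separated K-SEP′ closers (which conclude
`PSRankOneLowerHalfAtThree ∧ PSRankOneUpperHalfAtThree`): both halves ⟺ «∀ W globally minimal on the
irreducible principal-series rows with `r_an = 1`, `MissingLowerBoundAt W 3 ∧ MissingUpperBoundAt W 3`».
[cite: Serre1972, §2.4 Prop. 15] -/
theorem psRankOne_halves_iff_min :
    (PSRankOneLowerHalfAtThree ∧ PSRankOneUpperHalfAtThree) ↔
      ∀ (W : WeierstrassCurve ℚ) [W.IsElliptic] [W.IsGloballyMinimal], ClassO6 W 3 → Irr W 3 →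
        Even (padicValInt 3 W.minimalDiscriminantInt) →
        W.minimalDiscriminantInt / 3 ^ padicValInt 3 W.minimalDiscriminantInt % 3 = 1 →
        W.analyticRank = 1 → Typed.MissingLowerBoundAt W 3 ∧ Typed.MissingUpperBoundAt W 3 := by
  rw [psRankOneLowerHalfAtThree_iff_min, psRankOneUpperHalfAtThree_iff_min]
  exact ⟨fun ⟨h₁, h₂⟩ W _ _ hO6 hirr hev hsq hr ↦ ⟨h₁ W hO6 hirr hev hsq hr, h₂ W hO6 hirr hev hsq hr⟩,
    fun h ↦ ⟨fun W _ _ hO6 hirr hev hsq hr ↦ (h W hO6 hirr hev hsq hr).1,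
      fun W _ _ hO6 hirr hev hsq hr ↦ (h W hO6 hirr hev hsq hr).2⟩⟩

end Summit.BirchSwinnertonDyer.BirchSwinnertonDyer.Theorems.PSIrrSurjThree

end
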